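import Summits.AtomisticToContinuum.Crystallization.Theses.HolmgrenBoyleLind
import Summits.AtomisticToContinuum.Crystallization.Theorems.ExcessDecayLiouvilleForceTail

/-!
# Route `HolmgrenBoyleLind`, crux `GroundStatesChargeFLCEquilibrium`: the near-field transfer step

Support file for item stmt-AtomisticToContinuum-6076 (crux
`HolmgrenBoyleLind.GroundStatesChargeFLCEquilibrium`), stub `stub_nearFieldTransfer` of the
registered line: the deterministic transfer of near-field force information from matched finite
configurations to the charged set. Let `Λ ⊂ ℝ³` be `δ'`-separated, `q₀ ∈ Λ`, and suppose that for
all `R, ε > 0` there is a finite `δ₀`-separated configuration `x` with a near-field force bound of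
constant `C` (for every particle `k`, radius `ρ ≥ 1` and finite index set `B ∌ k` containing all
`j ≠ k` with `dist (x j) (x k) < ρ`, the force on `x k` from `B` has norm `≤ C/ρ⁴`), a particle `i`
and a linear isometry `A` such that the `R`-neighbourhood of `x i` is two-way `ε`-matched with
`x i + A (Λ − q₀)`. Then, with `C' := 16 C + 1`, for every `q ∈ Λ` and `R ≥ 2` the force on `q` from
the points `s ∈ Λ ∖ {q}` with `dist s q < R` has norm `≤ C'/R⁴`.

Proof. Write `Φ v := (V′(‖v‖)/‖v‖) • v` for the pair force as a function of the bond vector. `Φ` is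
continuous away from `0` (`continuousOn_ljForceVec`), hence uniformly continuous on the compact
annulus `{δ'/2 ≤ ‖v‖ ≤ R + 1}` (`ljForceVec_uniform`): modulus `τ` for `η := 1/((#T + 1) R⁴)`. Take
`ε := min (τ/3) (δ₀/5) (δ'/5) (1/6)` and the witness at radius `R + dist q q₀ + 1`; `k :=` the
particle matched to `q`; each `s ∈ T` has a particle `J s` with `‖(x k − x (J s)) − A (q − s)‖ ≤ 2ε`
(linearity of `A`); `J` is injective on `T` (`4ε < δ'`), `J s ≠ k`, and every `j ≠ k` with
`dist (x j) (x k) < R − 3ε` is some `J s` (`4ε < δ₀`); so the near-field bound at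
`ρ := R − 3ε ≥ R/2` with `B := T.image J` gives `‖Σ_{s ∈ T} Φ (x k − x (J s))‖ ≤ 16 C/R⁴`, while
`Σ_{s ∈ T} Φ (A (q − s)) = A (Σ_{s ∈ T} Φ (q − s))` (`ljForceVec_map`) has the same norm as the
target and differs from the particle sum by `≤ #T · η ≤ 1/R⁴`.

All `[folklore]`; nothing here closes an item.
-/

noncomputable section

namespace Summit.AtomisticToContinuum.Crystallization.Theorems.HolmgrenBoyleLindGroundStatesChargeFLCEquilibrium

open Literature.MathematicalPhysics.StatisticalMechanics

/-- The pair force `Φ v = (V′(‖v‖)/‖v‖) • v` is continuous in the bond vector `v ≠ 0`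
(`V′(r) = −r⁻¹³ + r⁻⁷` for `r ≠ 0`). [folklore] -/
theorem continuousOn_ljForceVec :
    ContinuousOn (fun v : EuclideanSpace ℝ (Fin 3) => (deriv lennardJones ‖v‖ / ‖v‖) • v)
      {v : EuclideanSpace ℝ (Fin 3) | v ≠ 0} := by
  have h0 : ∀ v ∈ {v : EuclideanSpace ℝ (Fin 3) | v ≠ 0}, ‖v‖ ≠ 0 :=
    fun v hv => norm_ne_zero_iff.mpr hv
  have h : ContinuousOn
      (fun v : EuclideanSpace ℝ (Fin 3) => ((-(‖v‖⁻¹) ^ 13 + (‖v‖⁻¹) ^ 7) / ‖v‖) • v)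
      {v : EuclideanSpace ℝ (Fin 3) | v ≠ 0} := by
    fun_prop (disch := assumption)
  refine h.congr fun v hv => ?_
  simp only [PhononStabilityNegative.deriv_lennardJones (h0 v hv)]

/-- Uniform continuity of the pair force `Φ v = (V′(‖v‖)/‖v‖) • v` on the compact annulus
`{a ≤ ‖v‖ ≤ b}`, `a > 0`, in `ε`–`δ` form. [folklore] -/
theorem ljForceVec_uniform {a b η : ℝ} (ha : 0 < a) (hη : 0 < η) :
    ∃ τ > 0, ∀ v w : EuclideanSpace ℝ (Fin 3), a ≤ ‖v‖ → ‖v‖ ≤ b → a ≤ ‖w‖ → ‖w‖ ≤ b →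
      dist v w < τ →
      dist ((deriv lennardJones ‖v‖ / ‖v‖) • v) ((deriv lennardJones ‖w‖ / ‖w‖) • w) < η := by
  have hK : IsCompact {v : EuclideanSpace ℝ (Fin 3) | a ≤ ‖v‖ ∧ ‖v‖ ≤ b} := by
    have h1 : {v : EuclideanSpace ℝ (Fin 3) | a ≤ ‖v‖ ∧ ‖v‖ ≤ b} =
        {v : EuclideanSpace ℝ (Fin 3) | a ≤ ‖v‖} ∩
          Metric.closedBall (0 : EuclideanSpace ℝ (Fin 3)) b := by
      ext v
      simp [Metric.mem_closedBall, dist_zero_right]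
    rw [h1]
    exact (isCompact_closedBall (0 : EuclideanSpace ℝ (Fin 3)) b).inter_left
      (isClosed_le continuous_const continuous_norm)
  have hc : ContinuousOn
      (fun v : EuclideanSpace ℝ (Fin 3) => (deriv lennardJones ‖v‖ / ‖v‖) • v)
      {v : EuclideanSpace ℝ (Fin 3) | a ≤ ‖v‖ ∧ ‖v‖ ≤ b} := by
    refine continuousOn_ljForceVec.mono fun v hv => ?_
    simp only [Set.mem_setOf_eq] at hv ⊢
    intro h0
    rw [h0, norm_zero] at hv
    linarith [hv.1]
  obtain ⟨τ, hτ, h⟩ :=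
    Metric.uniformContinuousOn_iff.1 (hK.uniformContinuousOn_of_continuous hc) η hη
  exact ⟨τ, hτ, fun v w hav hvb haw hwb hvw => h v ⟨hav, hvb⟩ w ⟨haw, hwb⟩ hvw⟩

/-- The pair force is equivariant under linear isometries: `Φ (A u) = A (Φ u)`. [folklore] -/
theorem ljForceVec_map (A : EuclideanSpace ℝ (Fin 3) →ₗᵢ[ℝ] EuclideanSpace ℝ (Fin 3))
    (u : EuclideanSpace ℝ (Fin 3)) :
    (deriv lennardJones ‖A u‖ / ‖A u‖) • A u = A ((deriv lennardJones ‖u‖ / ‖u‖) • u) := by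
  rw [LinearIsometry.map_smul, LinearIsometry.norm_map]

/-- **Stub 3b — near-field transfer from matched configurations to the charged set.** Let `Λ` be
`δ'`-separated, `q₀ ∈ Λ`, and suppose that for all `R, ε > 0` there is a finite `δ₀`-separated
configuration `x` with the near-field force bound of constant `C`, a particle `i` and a linear
isometry `A` such that the `R`-neighbourhood of `x i` is two-way `ε`-matched with
`x i + A (Λ − q₀)`. Then for some `C'` (namely `16 C + 1`) and every `q ∈ Λ`, `R ≥ 2`: the force on
`q` from the points `s ∈ Λ ∖ {q}` with `dist s q < R` has norm `≤ C'/R⁴`. [folklore] -/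
theorem stub_nearFieldTransfer :
    ∀ (Λ : Set (EuclideanSpace ℝ (Fin 3))) (δ' : ℝ), 0 < δ' →
      (∀ x ∈ Λ, ∀ y ∈ Λ, x ≠ y → δ' ≤ dist x y) → ∀ q₀ ∈ Λ, ∀ (δ₀ C : ℝ), 0 < δ₀ →
      (∀ R ε : ℝ, 0 < R → 0 < ε →
        ∃ (N : ℕ) (x : Fin N → EuclideanSpace ℝ (Fin 3)) (i : Fin N)
          (A : EuclideanSpace ℝ (Fin 3) →ₗᵢ[ℝ] EuclideanSpace ℝ (Fin 3)),
          (∀ a b : Fin N, a ≠ b → δ₀ ≤ dist (x a) (x b)) ∧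
          (∀ (k : Fin N) (ρ : ℝ), 1 ≤ ρ → ∀ B : Finset (Fin N), k ∉ B →
            (∀ j : Fin N, j ≠ k → dist (x j) (x k) < ρ → j ∈ B) →
            ‖∑ j ∈ B, (deriv lennardJones (dist (x k) (x j)) / dist (x k) (x j)) • (x k - x j)‖ ≤
              C / ρ ^ 4) ∧
          (∀ s ∈ Λ, dist s q₀ ≤ R → ∃ j : Fin N, dist (x j) (x i + A (s - q₀)) ≤ ε) ∧
          (∀ j : Fin N, dist (x j) (x i) ≤ R → ∃ s ∈ Λ, dist (x j) (x i + A (s - q₀)) ≤ ε)) →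
      ∃ C' : ℝ, ∀ q ∈ Λ, ∀ R : ℝ, 2 ≤ R → ∀ T : Finset (EuclideanSpace ℝ (Fin 3)),
        (∀ s : EuclideanSpace ℝ (Fin 3), s ∈ T ↔ s ∈ Λ ∧ s ≠ q ∧ dist s q < R) →
        ‖∑ s ∈ T, (deriv lennardJones (dist q s) / dist q s) • (q - s)‖ ≤ C' / R ^ 4 := by
  intro Λ δ' hδ' hΛ q₀ hq₀ δ₀ C hδ₀ H
  refine ⟨16 * C + 1, ?_⟩
  intro q hq R hR T hT
  -- the pair force as a function of the bond vector
  set Φ : EuclideanSpace ℝ (Fin 3) → EuclideanSpace ℝ (Fin 3) :=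
    fun v => (deriv lennardJones ‖v‖ / ‖v‖) • v with hΦ
  have hsumΦ : ∑ s ∈ T, (deriv lennardJones (dist q s) / dist q s) • (q - s) =
      ∑ s ∈ T, Φ (q - s) := by
    refine Finset.sum_congr rfl fun s _ => ?_
    simp only [hΦ, dist_eq_norm]
  rw [hsumΦ]
  have hR0 : 0 < R := by linarith
  have hR4 : 0 < R ^ 4 := by positivity
  -- (i) uniform continuity of the pair force on the annulus `{δ'/2 ≤ ‖v‖ ≤ R + 1}`
  have hη : 0 < 1 / ((T.card + 1 : ℝ) * R ^ 4) := by positivity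
  obtain ⟨τ, hτ, hτU⟩ := ljForceVec_uniform (a := δ' / 2) (b := R + 1) (by positivity) hη
  -- (ii) the tolerance `ε` and the matched configuration at radius `R + dist q q₀ + 1`
  obtain ⟨ε, hε, hετ, hεδ₀, hεδ', hε6⟩ :
      ∃ ε : ℝ, 0 < ε ∧ ε ≤ τ / 3 ∧ ε ≤ δ₀ / 5 ∧ ε ≤ δ' / 5 ∧ ε ≤ 1 / 6 :=
    ⟨min (τ / 3) (min (δ₀ / 5) (min (δ' / 5) (1 / 6))), by positivity, min_le_left _ _,
      (min_le_right _ _).trans (min_le_left _ _),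
      (min_le_right _ _).trans ((min_le_right _ _).trans (min_le_left _ _)),
      (min_le_right _ _).trans ((min_le_right _ _).trans (min_le_right _ _))⟩
  have hd0 : 0 ≤ dist q q₀ := dist_nonneg
  obtain ⟨N, x, i, A, hsep₀, hnear, m1, m2⟩ := H (R + dist q q₀ + 1) ε (by positivity) hε
  -- (iii) the particle `k` matched to `q`, the particles `J s` matched to the points of `T`
  obtain ⟨k, hk⟩ := m1 q hq (by linarith)
  have hTm : ∀ s ∈ T, ∃ j : Fin N, dist (x j) (x i + A (s - q₀)) ≤ ε := by
    intro s hs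
    obtain ⟨hsΛ, -, hsq⟩ := (hT s).1 hs
    refine m1 s hsΛ ?_
    linarith [dist_triangle s q q₀]
  haveI : Nonempty (Fin N) := ⟨k⟩
  choose! J hJ using hTm
  -- re-basing from `q₀` to `q`: the key identity and the `2ε`-closeness it yields
  have hkey : ∀ (j : Fin N) (s : EuclideanSpace ℝ (Fin 3)),
      (x k - x j) - A (q - s) = (x k - (x i + A (q - q₀))) - (x j - (x i + A (s - q₀))) := by
    intro j s
    have hA : A (q - s) = A (q - q₀) - A (s - q₀) := by
      rw [← map_sub, sub_sub_sub_cancel_right]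
    rw [hA]
    abel
  have hclose : ∀ (j : Fin N) (s : EuclideanSpace ℝ (Fin 3)), dist (x j) (x i + A (s - q₀)) ≤ ε →
      ‖(x k - x j) - A (q - s)‖ ≤ 2 * ε := by
    intro j s hjs
    rw [hkey]
    calc ‖(x k - (x i + A (q - q₀))) - (x j - (x i + A (s - q₀)))‖
        ≤ ‖x k - (x i + A (q - q₀))‖ + ‖x j - (x i + A (s - q₀))‖ := norm_sub_le _ _
      _ = dist (x k) (x i + A (q - q₀)) + dist (x j) (x i + A (s - q₀)) := by
          rw [dist_eq_norm, dist_eq_norm]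
      _ ≤ ε + ε := add_le_add hk hjs
      _ = 2 * ε := by ring
  have hnA : ∀ s : EuclideanSpace ℝ (Fin 3), ‖A (q - s)‖ = dist q s := fun s => by
    rw [LinearIsometry.norm_map, dist_eq_norm]
  -- (iv) `J` is injective on `T` and avoids `k`
  have hinj : Set.InjOn J (T : Set (EuclideanSpace ℝ (Fin 3))) := by
    intro s hs s' hs' hss'
    by_contra hne
    obtain ⟨hsΛ, -, -⟩ := (hT s).1 hs
    obtain ⟨hs'Λ, -, -⟩ := (hT s').1 hs'
    have h1 := hclose (J s) s (hJ s hs)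
    have h2 := hclose (J s') s' (hJ s' hs')
    rw [← hss'] at h2
    have hd : dist s s' ≤ 4 * ε := by
      have hA : A (q - s') - A (q - s) = A (s - s') := by
        rw [← map_sub, sub_sub_sub_cancel_left]
      calc dist s s' = ‖A (q - s') - A (q - s)‖ := by
            rw [hA, LinearIsometry.norm_map, dist_eq_norm]
        _ = ‖((x k - x (J s)) - A (q - s)) - ((x k - x (J s)) - A (q - s'))‖ := by
            congr 1; abel
        _ ≤ ‖(x k - x (J s)) - A (q - s)‖ + ‖(x k - x (J s)) - A (q - s')‖ := norm_sub_le _ _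
        _ ≤ 2 * ε + 2 * ε := add_le_add h1 h2
        _ = 4 * ε := by ring
    have := hΛ s hsΛ s' hs'Λ hne
    linarith
  have hJk : ∀ s ∈ T, J s ≠ k := by
    intro s hs hsk
    obtain ⟨hsΛ, hsq, -⟩ := (hT s).1 hs
    have h1 := hclose (J s) s (hJ s hs)
    rw [hsk, sub_self, zero_sub, norm_neg, hnA] at h1
    have := hΛ q hq s hsΛ (Ne.symm hsq)
    linarith
  -- (v) `B := T.image J` misses `k` and contains every particle within `R - 3ε` of `x k`
  have hkB : k ∉ T.image J := by
    rw [Finset.mem_image]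
    rintro ⟨s, hs, hsk⟩
    exact hJk s hs hsk
  have hcover : ∀ j : Fin N, j ≠ k → dist (x j) (x k) < R - 3 * ε → j ∈ T.image J := by
    intro j hjk hjρ
    have hji : dist (x j) (x i) ≤ R + dist q q₀ + 1 := by
      have h1 : dist (x k) (x i) ≤ dist (x k) (x i + A (q - q₀)) + dist (x i + A (q - q₀)) (x i) :=
        dist_triangle _ _ _
      have h2 : dist (x i + A (q - q₀)) (x i) = dist q q₀ := by
        rw [dist_eq_norm, add_sub_cancel_left, LinearIsometry.norm_map, ← dist_eq_norm]
      linarith [dist_triangle (x j) (x k) (x i)]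
    obtain ⟨s, hsΛ, hs⟩ := m2 j hji
    have h2 : ‖(x k - x j) - A (q - s)‖ ≤ 2 * ε := hclose j s hs
    have hsq : s ≠ q := by
      rintro rfl
      rw [sub_self, map_zero, sub_zero, ← dist_eq_norm, dist_comm] at h2
      have := hsep₀ j k hjk
      linarith
    have hsR : dist s q < R := by
      have h3 : dist q s ≤ ‖x k - x j‖ + ‖(x k - x j) - A (q - s)‖ := by
        rw [← hnA s]
        exact norm_le_norm_add_norm_sub _ _
      rw [← dist_eq_norm, dist_comm (x k)] at h3
      rw [dist_comm]
      linarith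
    have hsT : s ∈ T := (hT s).2 ⟨hsΛ, hsq, hsR⟩
    have hjs : j = J s := by
      by_contra hne
      have h3 := hclose (J s) s (hJ s hsT)
      have hd : dist (x j) (x (J s)) ≤ 4 * ε := by
        calc dist (x j) (x (J s))
            = ‖((x k - x (J s)) - A (q - s)) - ((x k - x j) - A (q - s))‖ := by
              rw [dist_eq_norm]; congr 1; abel
          _ ≤ ‖(x k - x (J s)) - A (q - s)‖ + ‖(x k - x j) - A (q - s)‖ := norm_sub_le _ _
          _ ≤ 2 * ε + 2 * ε := add_le_add h3 h2
          _ = 4 * ε := by ring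
      have := hsep₀ j (J s) hne
      linarith
    rw [hjs]
    exact Finset.mem_image_of_mem J hsT
  -- (vi) the near-field bound at `ρ := R - 3ε ≥ R/2`, rewritten as a sum over `T`
  have hbound := hnear k (R - 3 * ε) (by linarith) (T.image J) hkB hcover
  rw [Finset.sum_image hinj] at hbound
  have hboundΦ : ‖∑ s ∈ T, Φ (x k - x (J s))‖ ≤ C / (R - 3 * ε) ^ 4 := by
    have : ∑ s ∈ T, (deriv lennardJones (dist (x k) (x (J s))) / dist (x k) (x (J s))) •
        (x k - x (J s)) = ∑ s ∈ T, Φ (x k - x (J s)) := by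
      refine Finset.sum_congr rfl fun s _ => ?_
      simp only [hΦ, dist_eq_norm]
    rw [← this]
    exact hbound
  have hρ0 : 0 < R - 3 * ε := by linarith
  have hC : 0 ≤ C := by
    by_contra hC
    have : C / (R - 3 * ε) ^ 4 < 0 := div_neg_of_neg_of_pos (not_le.1 hC) (by positivity)
    linarith [norm_nonneg (∑ s ∈ T, Φ (x k - x (J s)))]
  have h16 : C / (R - 3 * ε) ^ 4 ≤ 16 * C / R ^ 4 := by
    calc C / (R - 3 * ε) ^ 4 ≤ C / (R / 2) ^ 4 := by
          apply div_le_div_of_nonneg_left hC (by positivity)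
          exact pow_le_pow_left₀ (by positivity) (by linarith) 4
      _ = 16 * C / R ^ 4 := by
          field_simp
          ring
  -- (vii) the particle sum is `#T • η`-close to the rotated target sum
  have hterm : ∀ s ∈ T,
      dist (Φ (x k - x (J s))) (Φ (A (q - s))) < 1 / ((T.card + 1 : ℝ) * R ^ 4) := by
    intro s hs
    obtain ⟨hsΛ, hsq, hsR⟩ := (hT s).1 hs
    have hw : ‖A (q - s)‖ = dist q s := hnA s
    have hqs : δ' ≤ dist q s := hΛ q hq s hsΛ (Ne.symm hsq)
    have hqs' : dist q s < R := by rw [dist_comm]; exact hsR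
    have hvw : ‖(x k - x (J s)) - A (q - s)‖ ≤ 2 * ε := hclose (J s) s (hJ s hs)
    have hvb := abs_le.1 ((abs_norm_sub_norm_le (x k - x (J s)) (A (q - s))).trans hvw)
    have hv1 : δ' / 2 ≤ ‖x k - x (J s)‖ := by linarith [hvb.1]
    have hv2 : ‖x k - x (J s)‖ ≤ R + 1 := by linarith [hvb.2]
    refine hτU _ _ hv1 hv2 (by linarith) (by linarith) ?_
    rw [dist_eq_norm]
    linarith
  have hdiff : ‖∑ s ∈ T, Φ (x k - x (J s)) - ∑ s ∈ T, Φ (A (q - s))‖ ≤ 1 / R ^ 4 := by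
    rw [← Finset.sum_sub_distrib]
    have hc1 : (T.card + 1 : ℝ) ≠ 0 := by positivity
    calc ‖∑ s ∈ T, (Φ (x k - x (J s)) - Φ (A (q - s)))‖
        ≤ ∑ s ∈ T, ‖Φ (x k - x (J s)) - Φ (A (q - s))‖ := norm_sum_le _ _
      _ ≤ ∑ s ∈ T, 1 / ((T.card + 1 : ℝ) * R ^ 4) := Finset.sum_le_sum fun s hs => by
          rw [← dist_eq_norm]; exact (hterm s hs).le
      _ = T.card * (1 / ((T.card + 1 : ℝ) * R ^ 4)) := by rw [Finset.sum_const, nsmul_eq_mul]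
      _ ≤ (T.card + 1 : ℝ) * (1 / ((T.card + 1 : ℝ) * R ^ 4)) := by gcongr; linarith
      _ = 1 / R ^ 4 := by rw [mul_one_div, ← div_div, div_self hc1]
  -- (viii) equivariance: the rotated target sum is `A` of the target sum, of the same norm
  have hAsum : ∑ s ∈ T, Φ (A (q - s)) = A (∑ s ∈ T, Φ (q - s)) := by
    rw [map_sum]
    refine Finset.sum_congr rfl fun s _ => ?_
    simp only [hΦ]
    exact ljForceVec_map A (q - s)
  calc ‖∑ s ∈ T, Φ (q - s)‖ = ‖∑ s ∈ T, Φ (A (q - s))‖ := by rw [hAsum, LinearIsometry.norm_map]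
    _ ≤ ‖∑ s ∈ T, Φ (x k - x (J s))‖ +
          ‖∑ s ∈ T, Φ (x k - x (J s)) - ∑ s ∈ T, Φ (A (q - s))‖ := norm_le_norm_add_norm_sub _ _
    _ ≤ 16 * C / R ^ 4 + 1 / R ^ 4 := add_le_add (hboundΦ.trans h16) hdiff
    _ = (16 * C + 1) / R ^ 4 := by ring

end Summit.AtomisticToContinuum.Crystallization.Theorems.HolmgrenBoyleLindGroundStatesChargeFLCEquilibrium

end
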